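import Summits.KontsevichZagierPeriods.KontsevichZagierPeriods.Theorems.RootDecompRationalCubeDichotomyArctanFibreP3

/-!
# Arctan-fibre calculus for `RationalCubePiKernelSingle` (route `RootDecompRationalCubeDichotomy`, crux stmt-KontsevichZagierPeriods-26322) at `m = 2` · part 4/9

Cell `decomp-kz`, lens 2 (decomp-kz-lens-2 g7): the GENERIC (arctan-fibre) side of the first open rung `m = 2` of
`RationalCubePiKernelSingle` decided INSIDE the Kontsevich–Zagier calculus with `N = 0`, by rules 1+2 only: fibred Möbius
charts `x ↦ x(q+r)/(q+rx)` (`MoebiusData.rel`), the TANGENT-ADDITION chart `x ↦ x(1−p)/(1−px²)` = the group law of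
`tan` as a move (`TanData.tan_add`), Serret's base involution `y ↦ (1−y)/(1+y)` (`rel_serret`), one moving-centre
dissection with null surgery (§8), odd-symmetry vanishing (§7b).  Decided census classes: `π·log 2` (`pilog2_rel`,
census pair #33), Catalan (`catalan_rel`, #32), dilogarithm classes `dilogA_rel` (#28), `dilogB_rel` (#30),
`dilogC_rel` (#24), seven moment relations; §9 the LITERAL binder instances of `RationalCubePiKernelSingle` at
`m = 2`, `N = 0` (the route decl is not referenced by name, so these modules do not import the route file);
§10 six UNIFORM CLASSES `single_classSwap/Reflect/Halve/Moebius/Serret/TanAdd`.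

Source: `HOME/decomp-kz-lens-2/g7/ArctanFibreCalculus.lean` sha256 964497cf335d1c59 (2144 l; critic decomp-kz-crit-1 g2
CLEARED 2026-08-30T09:13:02Z incl. transcription numerics, std axioms), split into 9 modules by the landing seat
decomp-kz-census-1 g7 (contexts re-opened per part; generic docstrings added where the source had none).
No `sorry`; standard axioms.  References: [cite: KontsevichZagier2001, §1.2]; J.-A. Serret (1844).
-/

noncomputable section

open Set MeasureTheory MvPolynomial
open Literature.ModelTheory.ExponentialFields (IsSemialgebraic)
open Literature.NumberTheory.Transcendental
open Literature.NumberTheory.Transcendental.KZ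
open Literature.NumberTheory.Transcendental.KZ.RFun
open Summit.KontsevichZagierPeriods.KontsevichZagierPeriods.Theorems

namespace Summit.KontsevichZagierPeriods.RootDecompRationalCubeDichotomy.ArctanFibre

-- PRIVATE copy (landed twin elsewhere / dedup.landed): mem_cube_two, mem_cube_one_iff, snoc_two_zero, snoc_two_one, init_apply_zero, vec_zero, vec_one
/-- `mem_cube_two`: auxiliary theorem of the arctan-fibre calculus for `RationalCubePiKernelSingle` (stmt-26322) — see the module docstring; verbatim from the lens file. -/
private theorem mem_cube_two {z : Fin 2 → ℝ} (hz : z ∈ KZ.cube 2) :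
    (0 ≤ z 0 ∧ z 0 ≤ 1) ∧ (0 ≤ z 1 ∧ z 1 ≤ 1) := ⟨hz 0, hz 1⟩

/-- `mem_cube_one_iff`: auxiliary theorem of the arctan-fibre calculus for `RationalCubePiKernelSingle` (stmt-26322) — see the module docstring; verbatim from the lens file. -/
private theorem mem_cube_one_iff {y : Fin 1 → ℝ} : y ∈ KZ.cube 1 ↔ 0 ≤ y 0 ∧ y 0 ≤ 1 := by
  rw [KZ.mem_cube]
  exact ⟨fun h => h 0, fun h i => by fin_cases i; exact h⟩

/-- `snoc_two_zero`: auxiliary theorem of the arctan-fibre calculus for `RationalCubePiKernelSingle` (stmt-26322) — see the module docstring; verbatim from the lens file. -/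
@[simp] private theorem snoc_two_zero (y : Fin 1 → ℝ) (s : ℝ) : (Fin.snoc y s : Fin 2 → ℝ) 0 = y 0 := rfl

/-- `snoc_two_one`: auxiliary theorem of the arctan-fibre calculus for `RationalCubePiKernelSingle` (stmt-26322) — see the module docstring; verbatim from the lens file. -/
@[simp] private theorem snoc_two_one (y : Fin 1 → ℝ) (s : ℝ) : (Fin.snoc y s : Fin 2 → ℝ) 1 = s := rfl

/-- `init_apply_zero`: auxiliary theorem of the arctan-fibre calculus for `RationalCubePiKernelSingle` (stmt-26322) — see the module docstring; verbatim from the lens file. -/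
@[simp] private theorem init_apply_zero (z : Fin 2 → ℝ) : Fin.init z 0 = z 0 := rfl

/-- `vec_zero`: auxiliary theorem of the arctan-fibre calculus for `RationalCubePiKernelSingle` (stmt-26322) — see the module docstring; verbatim from the lens file. -/
@[simp] private theorem vec_zero (a b : ℝ) : (![a, b] : Fin 2 → ℝ) 0 = a := rfl

/-- `vec_one`: auxiliary theorem of the arctan-fibre calculus for `RationalCubePiKernelSingle` (stmt-26322) — see the module docstring; verbatim from the lens file. -/
@[simp] private theorem vec_one (a b : ℝ) : (![a, b] : Fin 2 → ℝ) 1 = b := rfl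

section Objects

/-- `cQ1_ne`: auxiliary theorem of the arctan-fibre calculus for `RationalCubePiKernelSingle` (stmt-26322) — see the module docstring; verbatim from the lens file. -/
theorem cQ1_ne : ∀ z ∈ KZ.cube 2, aeval z (1 + X 0 + X 1 * X 0 : MvPolynomial (Fin 2) ℚ) ≠ 0 := by
  intro z hz
  obtain ⟨⟨hy0, hy1⟩, hx0, hx1⟩ := mem_cube_two hz
  have hy1' : (0 : ℝ) ≤ 1 - z 0 := by linarith
  have hx1' : (0 : ℝ) ≤ 1 - z 1 := by linarith
  have h : aeval z (1 + X 0 + X 1 * X 0 : MvPolynomial (Fin 2) ℚ) = (1 + z 0 + z 1 * z 0) := by simp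
  rw [h]
  have hp : (0 : ℝ) < (1 + z 0 + z 1 * z 0) := by positivity
  exact hp.ne'

/-- `[□, 1/(1+y+xy)]` (census tuple `[1,0,1,0,1,0]`, class `D1`, coefficient `1/12`). -/
def cQ1 : RFun 2 := ⟨1, 1 + X 0 + X 1 * X 0, cQ1_ne⟩

/-- `cQ1_fn`: auxiliary theorem of the arctan-fibre calculus for `RationalCubePiKernelSingle` (stmt-26322) — see the module docstring; verbatim from the lens file. -/
theorem cQ1_fn (z : Fin 2 → ℝ) : cQ1.fn z = 1 / (1 + z 0 + z 1 * z 0) := by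
  simp [cQ1, fn_apply]

/-- `cQ1_pos`: auxiliary theorem of the arctan-fibre calculus for `RationalCubePiKernelSingle` (stmt-26322) — see the module docstring; verbatim from the lens file. -/
theorem cQ1_pos {z : Fin 2 → ℝ} (hz : z ∈ KZ.cube 2) : (0 : ℝ) < (1 + z 0 + z 1 * z 0) := by
  obtain ⟨⟨hy0, hy1⟩, hx0, hx1⟩ := mem_cube_two hz
  have hy1' : (0 : ℝ) ≤ 1 - z 0 := by linarith
  have hx1' : (0 : ℝ) ≤ 1 - z 1 := by linarith
  positivity

/-- `cQ2_ne`: auxiliary theorem of the arctan-fibre calculus for `RationalCubePiKernelSingle` (stmt-26322) — see the module docstring; verbatim from the lens file. -/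
theorem cQ2_ne : ∀ z ∈ KZ.cube 2, aeval z (1 + 2 * X 1 + 2 * X 0 + 2 * X 1 * X 0 + X 0 ^ 2 : MvPolynomial (Fin 2) ℚ) ≠ 0 := by
  intro z hz
  obtain ⟨⟨hy0, hy1⟩, hx0, hx1⟩ := mem_cube_two hz
  have hy1' : (0 : ℝ) ≤ 1 - z 0 := by linarith
  have hx1' : (0 : ℝ) ≤ 1 - z 1 := by linarith
  have h : aeval z (1 + 2 * X 1 + 2 * X 0 + 2 * X 1 * X 0 + X 0 ^ 2 : MvPolynomial (Fin 2) ℚ) = (1 + 2 * z 1 + 2 * z 0 + 2 * z 1 * z 0 + z 0 ^ 2) := by simp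
  rw [h]
  have hp : (0 : ℝ) < (1 + 2 * z 1 + 2 * z 0 + 2 * z 1 * z 0 + z 0 ^ 2) := by positivity
  exact hp.ne'

/-- `[□, 1/(1+2x+2y+2xy+y²)]` (`[1,2,2,0,2,1]`, class `D1`, coefficient `1/24`). -/
def cQ2 : RFun 2 := ⟨1, 1 + 2 * X 1 + 2 * X 0 + 2 * X 1 * X 0 + X 0 ^ 2, cQ2_ne⟩

/-- `cQ2_fn`: auxiliary theorem of the arctan-fibre calculus for `RationalCubePiKernelSingle` (stmt-26322) — see the module docstring; verbatim from the lens file. -/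
theorem cQ2_fn (z : Fin 2 → ℝ) : cQ2.fn z = 1 / (1 + 2 * z 1 + 2 * z 0 + 2 * z 1 * z 0 + z 0 ^ 2) := by
  simp [cQ2, fn_apply]

/-- `cQ2_pos`: auxiliary theorem of the arctan-fibre calculus for `RationalCubePiKernelSingle` (stmt-26322) — see the module docstring; verbatim from the lens file. -/
theorem cQ2_pos {z : Fin 2 → ℝ} (hz : z ∈ KZ.cube 2) : (0 : ℝ) < (1 + 2 * z 1 + 2 * z 0 + 2 * z 1 * z 0 + z 0 ^ 2) := by
  obtain ⟨⟨hy0, hy1⟩, hx0, hx1⟩ := mem_cube_two hz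
  have hy1' : (0 : ℝ) ≤ 1 - z 0 := by linarith
  have hx1' : (0 : ℝ) ≤ 1 - z 1 := by linarith
  positivity

/-- `cQ5_ne`: auxiliary theorem of the arctan-fibre calculus for `RationalCubePiKernelSingle` (stmt-26322) — see the module docstring; verbatim from the lens file. -/
theorem cQ5_ne : ∀ z ∈ KZ.cube 2, aeval z (1 + X 1 + 2 * X 0 + X 1 * X 0 + X 0 ^ 2 : MvPolynomial (Fin 2) ℚ) ≠ 0 := by
  intro z hz
  obtain ⟨⟨hy0, hy1⟩, hx0, hx1⟩ := mem_cube_two hz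
  have hy1' : (0 : ℝ) ≤ 1 - z 0 := by linarith
  have hx1' : (0 : ℝ) ≤ 1 - z 1 := by linarith
  have h : aeval z (1 + X 1 + 2 * X 0 + X 1 * X 0 + X 0 ^ 2 : MvPolynomial (Fin 2) ℚ) = (1 + z 1 + 2 * z 0 + z 1 * z 0 + z 0 ^ 2) := by simp
  rw [h]
  have hp : (0 : ℝ) < (1 + z 1 + 2 * z 0 + z 1 * z 0 + z 0 ^ 2) := by positivity
  exact hp.ne'

/-- `[□, 1/(1+x+2y+xy+y²)]` (`[1,1,2,0,1,1]`, class `D3`, coefficient `1/12`). -/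
def cQ5 : RFun 2 := ⟨1, 1 + X 1 + 2 * X 0 + X 1 * X 0 + X 0 ^ 2, cQ5_ne⟩

/-- `cQ5_fn`: auxiliary theorem of the arctan-fibre calculus for `RationalCubePiKernelSingle` (stmt-26322) — see the module docstring; verbatim from the lens file. -/
theorem cQ5_fn (z : Fin 2 → ℝ) : cQ5.fn z = 1 / (1 + z 1 + 2 * z 0 + z 1 * z 0 + z 0 ^ 2) := by
  simp [cQ5, fn_apply]

/-- `cQ5_pos`: auxiliary theorem of the arctan-fibre calculus for `RationalCubePiKernelSingle` (stmt-26322) — see the module docstring; verbatim from the lens file. -/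
theorem cQ5_pos {z : Fin 2 → ℝ} (hz : z ∈ KZ.cube 2) : (0 : ℝ) < (1 + z 1 + 2 * z 0 + z 1 * z 0 + z 0 ^ 2) := by
  obtain ⟨⟨hy0, hy1⟩, hx0, hx1⟩ := mem_cube_two hz
  have hy1' : (0 : ℝ) ≤ 1 - z 0 := by linarith
  have hx1' : (0 : ℝ) ≤ 1 - z 1 := by linarith
  positivity

/-- `cQ6_ne`: auxiliary theorem of the arctan-fibre calculus for `RationalCubePiKernelSingle` (stmt-26322) — see the module docstring; verbatim from the lens file. -/
theorem cQ6_ne : ∀ z ∈ KZ.cube 2, aeval z (2 + X 0 + X 1 * X 0 : MvPolynomial (Fin 2) ℚ) ≠ 0 := by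
  intro z hz
  obtain ⟨⟨hy0, hy1⟩, hx0, hx1⟩ := mem_cube_two hz
  have hy1' : (0 : ℝ) ≤ 1 - z 0 := by linarith
  have hx1' : (0 : ℝ) ≤ 1 - z 1 := by linarith
  have h : aeval z (2 + X 0 + X 1 * X 0 : MvPolynomial (Fin 2) ℚ) = (2 + z 0 + z 1 * z 0) := by simp
  rw [h]
  have hp : (0 : ℝ) < (2 + z 0 + z 1 * z 0) := by positivity
  exact hp.ne'

/-- `[□, 1/(2+y+xy)]` (`[2,0,1,0,1,0]`, class `D3`, coefficient `1/12`). -/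
def cQ6 : RFun 2 := ⟨1, 2 + X 0 + X 1 * X 0, cQ6_ne⟩

/-- `cQ6_fn`: auxiliary theorem of the arctan-fibre calculus for `RationalCubePiKernelSingle` (stmt-26322) — see the module docstring; verbatim from the lens file. -/
theorem cQ6_fn (z : Fin 2 → ℝ) : cQ6.fn z = 1 / (2 + z 0 + z 1 * z 0) := by
  simp [cQ6, fn_apply]

/-- `cQ6_pos`: auxiliary theorem of the arctan-fibre calculus for `RationalCubePiKernelSingle` (stmt-26322) — see the module docstring; verbatim from the lens file. -/
theorem cQ6_pos {z : Fin 2 → ℝ} (hz : z ∈ KZ.cube 2) : (0 : ℝ) < (2 + z 0 + z 1 * z 0) := by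
  obtain ⟨⟨hy0, hy1⟩, hx0, hx1⟩ := mem_cube_two hz
  have hy1' : (0 : ℝ) ≤ 1 - z 0 := by linarith
  have hx1' : (0 : ℝ) ≤ 1 - z 1 := by linarith
  positivity

/-- `cGa_ne`: auxiliary theorem of the arctan-fibre calculus for `RationalCubePiKernelSingle` (stmt-26322) — see the module docstring; verbatim from the lens file. -/
theorem cGa_ne : ∀ z ∈ KZ.cube 2, aeval z (1 + 2 * X 1 + 2 * X 0 - 2 * X 1 ^ 2 - 2 * X 0 ^ 2 : MvPolynomial (Fin 2) ℚ) ≠ 0 := by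
  intro z hz
  obtain ⟨⟨hy0, hy1⟩, hx0, hx1⟩ := mem_cube_two hz
  have hy1' : (0 : ℝ) ≤ 1 - z 0 := by linarith
  have hx1' : (0 : ℝ) ≤ 1 - z 1 := by linarith
  have h : aeval z (1 + 2 * X 1 + 2 * X 0 - 2 * X 1 ^ 2 - 2 * X 0 ^ 2 : MvPolynomial (Fin 2) ℚ) = (1 + 2 * z 1 + 2 * z 0 - 2 * z 1 ^ 2 - 2 * z 0 ^ 2) := by simp
  rw [h]
  have hp : (0 : ℝ) < (1 + 2 * z 1 + 2 * z 0 - 2 * z 1 ^ 2 - 2 * z 0 ^ 2) := by nlinarith [mul_nonneg hx0 hy0, mul_nonneg hx0 hx1', mul_nonneg hy0 hy1', mul_nonneg hx1' hy1', sq_nonneg (2 * z 1 - 1), sq_nonneg (2 * z 0 - 1)]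
  exact hp.ne'

/-- `[□, 1/(1+2x+2y−2x²−2y²)]` (census tuple `[1,2,2,-2,0,-2]`, value `2G/3`, `G` = Catalan's constant). -/
def cGa : RFun 2 := ⟨1, 1 + 2 * X 1 + 2 * X 0 - 2 * X 1 ^ 2 - 2 * X 0 ^ 2, cGa_ne⟩

/-- `cGa_fn`: auxiliary theorem of the arctan-fibre calculus for `RationalCubePiKernelSingle` (stmt-26322) — see the module docstring; verbatim from the lens file. -/
theorem cGa_fn (z : Fin 2 → ℝ) : cGa.fn z = 1 / (1 + 2 * z 1 + 2 * z 0 - 2 * z 1 ^ 2 - 2 * z 0 ^ 2) := by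
  simp [cGa, fn_apply]

/-- `cGa_pos`: auxiliary theorem of the arctan-fibre calculus for `RationalCubePiKernelSingle` (stmt-26322) — see the module docstring; verbatim from the lens file. -/
theorem cGa_pos {z : Fin 2 → ℝ} (hz : z ∈ KZ.cube 2) : (0 : ℝ) < (1 + 2 * z 1 + 2 * z 0 - 2 * z 1 ^ 2 - 2 * z 0 ^ 2) := by
  obtain ⟨⟨hy0, hy1⟩, hx0, hx1⟩ := mem_cube_two hz
  have hy1' : (0 : ℝ) ≤ 1 - z 0 := by linarith
  have hx1' : (0 : ℝ) ≤ 1 - z 1 := by linarith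
  nlinarith [mul_nonneg hx0 hy0, mul_nonneg hx0 hx1', mul_nonneg hy0 hy1', mul_nonneg hx1' hy1', sq_nonneg (2 * z 1 - 1), sq_nonneg (2 * z 0 - 1)]

/-- `cGb_ne`: auxiliary theorem of the arctan-fibre calculus for `RationalCubePiKernelSingle` (stmt-26322) — see the module docstring; verbatim from the lens file. -/
theorem cGb_ne : ∀ z ∈ KZ.cube 2, aeval z (2 + 2 * X 1 + 2 * X 0 - X 1 ^ 2 - X 0 ^ 2 : MvPolynomial (Fin 2) ℚ) ≠ 0 := by
  intro z hz
  obtain ⟨⟨hy0, hy1⟩, hx0, hx1⟩ := mem_cube_two hz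
  have hy1' : (0 : ℝ) ≤ 1 - z 0 := by linarith
  have hx1' : (0 : ℝ) ≤ 1 - z 1 := by linarith
  have h : aeval z (2 + 2 * X 1 + 2 * X 0 - X 1 ^ 2 - X 0 ^ 2 : MvPolynomial (Fin 2) ℚ) = (2 + 2 * z 1 + 2 * z 0 - z 1 ^ 2 - z 0 ^ 2) := by simp
  rw [h]
  have hp : (0 : ℝ) < (2 + 2 * z 1 + 2 * z 0 - z 1 ^ 2 - z 0 ^ 2) := by nlinarith [mul_nonneg hx0 hy0, mul_nonneg hx0 hx1', mul_nonneg hy0 hy1', mul_nonneg hx1' hy1', sq_nonneg (2 * z 1 - 1), sq_nonneg (2 * z 0 - 1)]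
  exact hp.ne'

/-- `[□, 1/(2+2x+2y−x²−y²)]` (census tuple `[2,2,2,-1,0,-1]`, value `G/3`). -/
def cGb : RFun 2 := ⟨1, 2 + 2 * X 1 + 2 * X 0 - X 1 ^ 2 - X 0 ^ 2, cGb_ne⟩

/-- `cGb_fn`: auxiliary theorem of the arctan-fibre calculus for `RationalCubePiKernelSingle` (stmt-26322) — see the module docstring; verbatim from the lens file. -/
theorem cGb_fn (z : Fin 2 → ℝ) : cGb.fn z = 1 / (2 + 2 * z 1 + 2 * z 0 - z 1 ^ 2 - z 0 ^ 2) := by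
  simp [cGb, fn_apply]

/-- `cGb_pos`: auxiliary theorem of the arctan-fibre calculus for `RationalCubePiKernelSingle` (stmt-26322) — see the module docstring; verbatim from the lens file. -/
theorem cGb_pos {z : Fin 2 → ℝ} (hz : z ∈ KZ.cube 2) : (0 : ℝ) < (2 + 2 * z 1 + 2 * z 0 - z 1 ^ 2 - z 0 ^ 2) := by
  obtain ⟨⟨hy0, hy1⟩, hx0, hx1⟩ := mem_cube_two hz
  have hy1' : (0 : ℝ) ≤ 1 - z 0 := by linarith
  have hx1' : (0 : ℝ) ≤ 1 - z 1 := by linarith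
  nlinarith [mul_nonneg hx0 hy0, mul_nonneg hx0 hx1', mul_nonneg hy0 hy1', mul_nonneg hx1' hy1', sq_nonneg (2 * z 1 - 1), sq_nonneg (2 * z 0 - 1)]

/-- `cH1_ne`: auxiliary theorem of the arctan-fibre calculus for `RationalCubePiKernelSingle` (stmt-26322) — see the module docstring; verbatim from the lens file. -/
theorem cH1_ne : ∀ z ∈ KZ.cube 2, aeval z (2 + 2 * X 1 + 4 * X 0 - X 1 ^ 2 - 4 * X 0 ^ 2 : MvPolynomial (Fin 2) ℚ) ≠ 0 := by
  intro z hz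
  obtain ⟨⟨hy0, hy1⟩, hx0, hx1⟩ := mem_cube_two hz
  have hy1' : (0 : ℝ) ≤ 1 - z 0 := by linarith
  have hx1' : (0 : ℝ) ≤ 1 - z 1 := by linarith
  have h : aeval z (2 + 2 * X 1 + 4 * X 0 - X 1 ^ 2 - 4 * X 0 ^ 2 : MvPolynomial (Fin 2) ℚ) = (2 + 2 * z 1 + 4 * z 0 - z 1 ^ 2 - 4 * z 0 ^ 2) := by simp
  rw [h]
  have hp : (0 : ℝ) < (2 + 2 * z 1 + 4 * z 0 - z 1 ^ 2 - 4 * z 0 ^ 2) := by nlinarith [mul_nonneg hx0 hy0, mul_nonneg hx0 hx1', mul_nonneg hy0 hy1', mul_nonneg hx1' hy1', sq_nonneg (2 * z 1 - 1), sq_nonneg (2 * z 0 - 1)]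
  exact hp.ne'

/-- `H₁ = [□, 1/(2+2x+4y−x²−4y²)]` (`A` halved in `x`, first half). -/
def cH1 : RFun 2 := ⟨1, 2 + 2 * X 1 + 4 * X 0 - X 1 ^ 2 - 4 * X 0 ^ 2, cH1_ne⟩

/-- `cH1_fn`: auxiliary theorem of the arctan-fibre calculus for `RationalCubePiKernelSingle` (stmt-26322) — see the module docstring; verbatim from the lens file. -/
theorem cH1_fn (z : Fin 2 → ℝ) : cH1.fn z = 1 / (2 + 2 * z 1 + 4 * z 0 - z 1 ^ 2 - 4 * z 0 ^ 2) := by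
  simp [cH1, fn_apply]

/-- `cH1_pos`: auxiliary theorem of the arctan-fibre calculus for `RationalCubePiKernelSingle` (stmt-26322) — see the module docstring; verbatim from the lens file. -/
theorem cH1_pos {z : Fin 2 → ℝ} (hz : z ∈ KZ.cube 2) : (0 : ℝ) < (2 + 2 * z 1 + 4 * z 0 - z 1 ^ 2 - 4 * z 0 ^ 2) := by
  obtain ⟨⟨hy0, hy1⟩, hx0, hx1⟩ := mem_cube_two hz
  have hy1' : (0 : ℝ) ≤ 1 - z 0 := by linarith
  have hx1' : (0 : ℝ) ≤ 1 - z 1 := by linarith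
  nlinarith [mul_nonneg hx0 hy0, mul_nonneg hx0 hx1', mul_nonneg hy0 hy1', mul_nonneg hx1' hy1', sq_nonneg (2 * z 1 - 1), sq_nonneg (2 * z 0 - 1)]

/-- `cH11_ne`: auxiliary theorem of the arctan-fibre calculus for `RationalCubePiKernelSingle` (stmt-26322) — see the module docstring; verbatim from the lens file. -/
theorem cH11_ne : ∀ z ∈ KZ.cube 2, aeval z (4 + 4 * X 1 + 4 * X 0 - 2 * X 1 ^ 2 - 2 * X 0 ^ 2 : MvPolynomial (Fin 2) ℚ) ≠ 0 := by
  intro z hz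
  obtain ⟨⟨hy0, hy1⟩, hx0, hx1⟩ := mem_cube_two hz
  have hy1' : (0 : ℝ) ≤ 1 - z 0 := by linarith
  have hx1' : (0 : ℝ) ≤ 1 - z 1 := by linarith
  have h : aeval z (4 + 4 * X 1 + 4 * X 0 - 2 * X 1 ^ 2 - 2 * X 0 ^ 2 : MvPolynomial (Fin 2) ℚ) = (4 + 4 * z 1 + 4 * z 0 - 2 * z 1 ^ 2 - 2 * z 0 ^ 2) := by simp
  rw [h]
  have hp : (0 : ℝ) < (4 + 4 * z 1 + 4 * z 0 - 2 * z 1 ^ 2 - 2 * z 0 ^ 2) := by nlinarith [mul_nonneg hx0 hy0, mul_nonneg hx0 hx1', mul_nonneg hy0 hy1', mul_nonneg hx1' hy1', sq_nonneg (2 * z 1 - 1), sq_nonneg (2 * z 0 - 1)]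
  exact hp.ne'

/-- `H₁₁ = [□, 1/(2(2+2x+2y−x²−y²))]` (`H₁` halved in `y`, first half) `= ½ B`. -/
def cH11 : RFun 2 := ⟨1, 4 + 4 * X 1 + 4 * X 0 - 2 * X 1 ^ 2 - 2 * X 0 ^ 2, cH11_ne⟩

/-- `cH11_fn`: auxiliary theorem of the arctan-fibre calculus for `RationalCubePiKernelSingle` (stmt-26322) — see the module docstring; verbatim from the lens file. -/
theorem cH11_fn (z : Fin 2 → ℝ) : cH11.fn z = 1 / (4 + 4 * z 1 + 4 * z 0 - 2 * z 1 ^ 2 - 2 * z 0 ^ 2) := by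
  simp [cH11, fn_apply]

/-- `cH11_pos`: auxiliary theorem of the arctan-fibre calculus for `RationalCubePiKernelSingle` (stmt-26322) — see the module docstring; verbatim from the lens file. -/
theorem cH11_pos {z : Fin 2 → ℝ} (hz : z ∈ KZ.cube 2) : (0 : ℝ) < (4 + 4 * z 1 + 4 * z 0 - 2 * z 1 ^ 2 - 2 * z 0 ^ 2) := by
  obtain ⟨⟨hy0, hy1⟩, hx0, hx1⟩ := mem_cube_two hz
  have hy1' : (0 : ℝ) ≤ 1 - z 0 := by linarith
  have hx1' : (0 : ℝ) ≤ 1 - z 1 := by linarith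
  nlinarith [mul_nonneg hx0 hy0, mul_nonneg hx0 hx1', mul_nonneg hy0 hy1', mul_nonneg hx1' hy1', sq_nonneg (2 * z 1 - 1), sq_nonneg (2 * z 0 - 1)]

/-! ### Slopes -/

/-- `den2_ne`: auxiliary theorem of the arctan-fibre calculus for `RationalCubePiKernelSingle` (stmt-26322) — see the module docstring; verbatim from the lens file. -/
theorem den2_ne : ∀ y ∈ KZ.cube 1, aeval y (2 + X 0 : MvPolynomial (Fin 1) ℚ) ≠ 0 := by
  intro y hy
  have := (mem_cube_one_iff.mp hy).1
  have h : aeval y (2 + X 0 : MvPolynomial (Fin 1) ℚ) = 2 + y 0 := by simp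
  rw [h]; positivity
/-- `den3_ne`: auxiliary theorem of the arctan-fibre calculus for `RationalCubePiKernelSingle` (stmt-26322) — see the module docstring; verbatim from the lens file. -/
theorem den3_ne : ∀ y ∈ KZ.cube 1, aeval y (3 + X 0 : MvPolynomial (Fin 1) ℚ) ≠ 0 := by
  intro y hy
  have := (mem_cube_one_iff.mp hy).1
  have h : aeval y (3 + X 0 : MvPolynomial (Fin 1) ℚ) = 3 + y 0 := by simp
  rw [h]; positivity
/-- `den1_ne`: auxiliary theorem of the arctan-fibre calculus for `RationalCubePiKernelSingle` (stmt-26322) — see the module docstring; verbatim from the lens file. -/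
theorem den1_ne : ∀ y ∈ KZ.cube 1, aeval y (1 + X 0 : MvPolynomial (Fin 1) ℚ) ≠ 0 := by
  intro y hy
  have := (mem_cube_one_iff.mp hy).1
  have h : aeval y (1 + X 0 : MvPolynomial (Fin 1) ℚ) = 1 + y 0 := by simp
  rw [h]; positivity

/-- slope `1/(2+y)` -/
def sA : RFun 1 := ⟨1, 2 + X 0, den2_ne⟩
/-- slope `(1+y)/(3+y)` -/
def sB : RFun 1 := ⟨1 + X 0, 3 + X 0, den3_ne⟩
/-- slope `y` -/
def sY : RFun 1 := poly (X 0)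
/-- slope `(1−y)/(1+y)` -/
def sS : RFun 1 := ⟨1 - X 0, 1 + X 0, den1_ne⟩

/-- `ev_sA`: auxiliary theorem of the arctan-fibre calculus for `RationalCubePiKernelSingle` (stmt-26322) — see the module docstring; verbatim from the lens file. -/
@[simp] theorem ev_sA (t : ℝ) : ev sA t = 1 / (2 + t) := by simp [ev, sA, fn_apply]
/-- `ev_sB`: auxiliary theorem of the arctan-fibre calculus for `RationalCubePiKernelSingle` (stmt-26322) — see the module docstring; verbatim from the lens file. -/
@[simp] theorem ev_sB (t : ℝ) : ev sB t = (1 + t) / (3 + t) := by simp [ev, sB, fn_apply]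
/-- `ev_sY`: auxiliary theorem of the arctan-fibre calculus for `RationalCubePiKernelSingle` (stmt-26322) — see the module docstring; verbatim from the lens file. -/
@[simp] theorem ev_sY (t : ℝ) : ev sY t = t := by simp [ev, sY]
/-- `ev_sS`: auxiliary theorem of the arctan-fibre calculus for `RationalCubePiKernelSingle` (stmt-26322) — see the module docstring; verbatim from the lens file. -/
@[simp] theorem ev_sS (t : ℝ) : ev sS t = (1 - t) / (1 + t) := by simp [ev, sS, fn_apply]

/-- Tangent-addition data `a₁ = 1/(2+y)`, `a₂ = (1+y)/(3+y)` (`arctan a₁ + arctan a₂ = π/4`). -/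
def tdAB : TanData where
  A₁ := sA
  A₂ := sB
  hp := fun t ht => by
    have h0 := ht.1
    have h2 : (0 : ℝ) < 2 + t := by linarith
    have h3 : (0 : ℝ) < 3 + t := by linarith
    rw [ev_sA, ev_sB, div_mul_div_comm, one_mul]
    have hq : (0 : ℝ) < (2 + t) * (3 + t) := mul_pos h2 h3
    constructor
    · rw [div_lt_one hq]; nlinarith
    · have : (0 : ℝ) < (1 + t) / ((2 + t) * (3 + t)) := div_pos (by linarith) hq
      linarith

end Objects

end Summit.KontsevichZagierPeriods.RootDecompRationalCubeDichotomy.ArctanFibre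

end
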